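import Mathlib
import HarnessLib
import Literature.Analysis.FluidPDE.Tao2016AveragedNS.TaylorChainCertificate
import Summits.NavierStokesRegularity.NavierStokesRegularity.Theorems.TaylorModelRungThreeReadoutChainGlue

/-!
# Line `taylor-model` on crux K1b-DR (stmt-NavierStokesRegularity-23954) — stub G1 (`ChainEnclosureHolds`),
# helper 5: κ-RESTARTS — clause C4 of `ChainEnclosure`

A state `z` that is `κ j`-close (weighted window box) to the trajectory of an entry state `q` at a time `t` of
sub-step `s'` is restarted: (a) the base point `stAt φ j q t` lies in `TP j s' (t - Tn j s') + Ball(SpO - L1·κ)`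
(in-step bound of the node step run at level `(ρO - EO, EO)` from the level-`E` node at `Tn j s'`, and the `SpO`
clause of `Chain`) — note `Sp ≤ SpO` is NOT a certificate clause, so C3 is not used here; (b) the package's
Lipschitz deviation (F3) with `m := mT + (SpO - L1·κ)`, radius `κ`, on the rest of the sub-step, under the
κ-guard `bb·(mT + SpO + κ)·h < 1`, gives the entry deviation
`(m+κ)/(1 - bb(m+κ)u) - m/(1 - bb·m·u) = κ/((1 - bb(m+κ)u)(1 - bb·m·u)) ≤ L1·κ` (`lip_dev_le`, the `L1` clause);
(c) at the node `Tn j (s'+1)` the restarted state is a level-`EO` node (`E + L1·κ ≤ EO`); (d) the level-`EO` chain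
(`NodeO`, `nodeO_step`: step inequality `EO`, in-step `SpO - L1·κ`) from node `s'+1` (`chain_glue_from`) and
appending (`solvesOn_append`) give the remaining conjuncts. Result: `restart_C4`, clause C4 verbatim.

MODEL-lattice bookkeeping only (rung TL-M3); nothing here is a statement about the Navier–Stokes equations.
-/

noncomputable section

-- the sub-problem namespace repeats the summit name by design (D-0017)
set_option linter.dupNamespace false

namespace Summit.NavierStokesRegularity.NavierStokesRegularity.Theorems.TaylorModelReadout

open scoped BigOperators
open Set Finset Literature.Analysis.FluidPDE.TaoCascade Literature.Analysis.FluidPDE.TaoCascade.TaylorChain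

variable {cd : CertData} {φ : Flow}

/-! ### Level `EO` nodes -/

/-- Node predicate at level `EO` (restarted trajectories): `y = x j s + Cm j s ξ + e` on the window,
`|ξ| ≤ rP j s`, `e ∈ Ball(EO j s)`. [folklore] -/
def NodeO (cd : CertData) (j s : ℕ) (y : Fin 4 → ℤ → ℝ) : Prop :=
  ∃ ξ e : Fin 4 → ℤ → ℝ, (∀ i k, -cd.Kb ≤ k → k ≤ cd.Ka → |ξ i k| ≤ cd.rP j s i k ∧
    y i k = cd.x j s i k + cd.Cm j s ξ i k + e i k) ∧ cd.InBall j e (cd.EO j s)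

/-- `NodeO` only sees window components. [folklore] -/
theorem NodeO.congr {j s : ℕ} {y y' : Fin 4 → ℤ → ℝ} (h : NodeO cd j s y)
    (hyy : ∀ i k, -cd.Kb ≤ k → k ≤ cd.Ka → y i k = y' i k) : NodeO cd j s y' := by
  obtain ⟨ξ, e, hd, he⟩ := h
  exact ⟨ξ, e, fun i k h1 h2 => ⟨(hd i k h1 h2).1, (hyy i k h1 h2) ▸ (hd i k h1 h2).2⟩, he⟩

/-- A level-`E` node is a level-`EO` node (`E ≤ EO`). [folklore] -/
theorem NodeE.nodeO (hV : cd.Valid) {j : ℕ} (hj : j ≤ cd.N₀) {s : ℕ} (hs : s ≤ cd.S j) {y : Fin 4 → ℤ → ℝ}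
    (h : NodeE cd j s y) : NodeO cd j s y := by
  obtain ⟨ξ, e, hd, he⟩ := h
  obtain ⟨-, -, -, -, -, -, -, a8, -⟩ := (hV.2.2.1 j hj).2.2.2.2.2.2.1 s hs
  exact ⟨ξ, e, hd, inBall_mono (G2.valid_omega_pos hV hj) he a8⟩

/-- Every level-`EO` node state lies in the window ball of radius `mC j s + ρO j s`. [folklore] -/
theorem NodeO.inBall (hV : cd.Valid) {j : ℕ} (hj : j ≤ cd.N₀) {s : ℕ} (hs : s ≤ cd.S j) {y : Fin 4 → ℤ → ℝ}
    (h : NodeO cd j s y) : cd.InBall j y (cd.mC j s + cd.ρO j s) := by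
  obtain ⟨ξ, e, hd, he⟩ := h
  obtain ⟨-, -, -, a4, -, -, -, -, -, -, -, -, -, -, a15, -⟩ := (hV.2.2.1 j hj).2.2.2.2.2.2.1 s hs
  have hξ : ∀ i k, -cd.Kb ≤ k → k ≤ cd.Ka → |ξ i k| ≤ cd.rP j s i k := fun i k h1 h2 => (hd i k h1 h2).1
  have h1 : cd.InBall j (cd.x j s + cd.Cm j s ξ + e) (cd.mC j s + (cd.ρO j s - cd.EO j s) + cd.EO j s) :=
    inBall_add (inBall_add a4 (a15 ξ hξ).2) he
  intro i k hk1 hk2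
  rw [(hd i k hk1 hk2).2]
  exact inBall_of_eq h1 (by ring) i k hk1 hk2

/-- **Node step, level `EO`**, with the in-step enclosure `TP j s u + Ball(SpO j s - L1 j s·κ j)`.
[cite: Zgliczynski2002C1Lohner, §3–4] -/
theorem nodeO_step (hF : IsFlowPackage cd φ) (hV : cd.Valid) {j : ℕ} (hj : j ≤ cd.N₀) {s : ℕ} (hs : s < cd.S j)
    {y : Fin 4 → ℤ → ℝ} (hy : NodeO cd j s y) :
    NodeO cd j (s + 1) (stAt φ j y (cd.h j s)) ∧
      ∀ u ∈ Icc 0 (cd.h j s), cd.InBall j (stAt φ j y u - cd.TP j s u) (cd.SpO j s - cd.L1 j s * cd.κ j) := by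
  obtain ⟨ξ, e, hdec, he⟩ := hy
  have hω : ∀ k, 0 < cd.ω j k := G2.valid_omega_pos hV hj
  have hV' := hV
  obtain ⟨-, -, hC, -⟩ := hV'
  obtain ⟨-, -, -, -, -, -, hA, hB⟩ := hC j hj
  obtain ⟨-, -, -, -, -, a6, a7, a8, a9, -, -, -, -, -, a15, -⟩ := hA s hs.le
  obtain ⟨-, -, -, -, -, -, -, -, -, -, -, -, -, -, -, b16, -, -, b19, -⟩ := hB s hs
  have hξ : ∀ i k, -cd.Kb ≤ k → k ≤ cd.Ka → |ξ i k| ≤ cd.rP j s i k := fun i k h1 h2 => (hdec i k h1 h2).1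
  have hyd : ∀ i k, -cd.Kb ≤ k → k ≤ cd.Ka → y i k = cd.x j s i k + cd.Cm j s ξ i k + e i k :=
    fun i k h1 h2 => (hdec i k h1 h2).2
  have hf : 0 ≤ cd.ρO j s - cd.EO j s := sub_nonneg.2 a9
  have hε : 0 ≤ cd.EO j s := a6.trans (a7.trans a8)
  have hρE : cd.ρO j s - cd.EO j s + cd.EO j s = cd.ρO j s := sub_add_cancel _ _
  have hfe : cd.ρO j s - cd.EO j s + cd.EO j s ≤ cd.ρO j s := le_of_eq hρE
  have hCmξ : cd.InBall j (cd.Cm j s ξ) (cd.ρO j s - cd.EO j s) := (a15 ξ hξ).2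
  refine ⟨?_, fun u hu => ?_⟩
  · obtain ⟨hξ', he'⟩ := node_step hF hV hj hs hf hε hfe hξ hCmξ he hyd
    rw [hρE] at he'
    refine ⟨cd.Ci j (s + 1) (cd.Vap j s (cd.h j s) (cd.Cm j s ξ)),
      stAt φ j y (cd.h j s) - cd.x j (s + 1) - cd.Cm j (s + 1) (cd.Ci j (s + 1) (cd.Vap j s (cd.h j s) (cd.Cm j s ξ))),
      fun i k h1 h2 => ⟨hξ' i k h1 h2, ?_⟩, inBall_mono hω he' b19⟩
    simp only [Pi.sub_apply]
    ring
  · have h1 := inStep_bound hF hV hj hs hf hε hfe hCmξ he hyd hu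
    rw [hρE] at h1
    have h2 := inStep_radius_le hV hj hs (hε.trans a9) le_rfl hu
    exact inBall_mono hω h1 (by linarith)

/-! ### Two inequalities -/

/-- Radii of nonempty window balls are nonnegative (the window contains shell `1`: `0 ≤ Kb`, `1 ≤ Ka`). [folklore] -/
theorem inBall_radius_nonneg (hV : cd.Valid) {j : ℕ} (hj : j ≤ cd.N₀) {y : Fin 4 → ℤ → ℝ} {N : ℝ}
    (h : cd.InBall j y N) : 0 ≤ N := by
  obtain ⟨-, -, -, -, -, -, -, -, -, -, hKb, hKa, -⟩ := hV.1
  have h1 := h 0 1 (by linarith) hKa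
  have hω := G2.valid_omega_pos hV hj 1
  have h2 : 0 * cd.ω j 1 ≤ N * cd.ω j 1 := by rw [zero_mul]; exact (abs_nonneg _).trans h1
  exact le_of_mul_le_mul_right h2 hω

/-- **The entry deviation of a κ-restart.** For `0 ≤ u ≤ hh`, `m + κ ≤ M`, `b·M·hh < 1` and
`1/(1 - b·M·hh)² ≤ L`: `(m+κ)/(1 - b(m+κ)u) - m/(1 - b·m·u) ≤ L·κ` (the left side equals
`κ/((1 - b(m+κ)u)(1 - b·m·u))`). [folklore] -/
theorem lip_dev_le {b m κ u M hh L : ℝ} (hb : 0 ≤ b) (hm : 0 ≤ m) (hκ : 0 ≤ κ) (hu : 0 ≤ u) (huh : u ≤ hh)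
    (hM : m + κ ≤ M) (hg : b * M * hh < 1) (hL : 1 / (1 - b * M * hh) ^ 2 ≤ L) :
    (m + κ) / (1 - b * (m + κ) * u) - m / (1 - b * m * u) ≤ L * κ := by
  have hMu : b * (m + κ) * u ≤ b * M * hh := by
    have h1 : (m + κ) * u ≤ M * hh := mul_le_mul hM huh hu (by linarith)
    have h2 : b * ((m + κ) * u) ≤ b * (M * hh) := mul_le_mul_of_nonneg_left h1 hb
    linarith [mul_assoc b (m + κ) u, mul_assoc b M hh]
  have hC : 0 < 1 - b * M * hh := by linarith
  have hA : 0 < 1 - b * (m + κ) * u := by linarith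
  have hAB : 1 - b * (m + κ) * u ≤ 1 - b * m * u := by nlinarith [mul_nonneg (mul_nonneg hb hκ) hu]
  have hB : 0 < 1 - b * m * u := lt_of_lt_of_le hA hAB
  have key : (m + κ) / (1 - b * (m + κ) * u) - m / (1 - b * m * u) =
      κ / ((1 - b * (m + κ) * u) * (1 - b * m * u)) := by
    rw [div_sub_div _ _ hA.ne' hB.ne']
    congr 1
    ring
  rw [key]
  have h1 : κ / ((1 - b * (m + κ) * u) * (1 - b * m * u)) ≤ κ / (1 - b * (m + κ) * u) ^ 2 := by
    apply div_le_div_of_nonneg_left hκ (by positivity)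
    rw [sq]
    exact mul_le_mul_of_nonneg_left hAB hA.le
  have h2 : κ / (1 - b * (m + κ) * u) ^ 2 ≤ κ / (1 - b * M * hh) ^ 2 := by
    apply div_le_div_of_nonneg_left hκ (by positivity)
    have hCA : 1 - b * M * hh ≤ 1 - b * (m + κ) * u := by linarith
    nlinarith [mul_le_mul hCA hCA hC.le hA.le]
  calc κ / ((1 - b * (m + κ) * u) * (1 - b * m * u)) ≤ κ / (1 - b * M * hh) ^ 2 := h1.trans h2
    _ = 1 / (1 - b * M * hh) ^ 2 * κ := by ring
    _ ≤ L * κ := mul_le_mul_of_nonneg_right hL hκ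

/-! ### Clause C4 -/

section Restart

variable (hF : IsFlowPackage cd φ) (hV : cd.Valid) {j : ℕ} (hj : j ≤ cd.N₀)
include hF hV hj

/-- **Clause C4 of `ChainEnclosure` (κ-restarts)** for every entry state of the polytope.
[cite: Zgliczynski2002C1Lohner, §3–4] -/
theorem restart_C4 {q : Fin 4 → ℤ → ℝ} (hq : InPoly cd j q) :
    ∀ s', s' < cd.S j → ∀ t, cd.Tn j s' ≤ t → t ≤ cd.Tn j (s' + 1) →
      ∀ (z : (Fin 4 → ℤ → ℝ)), cd.InBall j (z - stAt φ j q t) (cd.κ j) →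
        SolvesOn cd φ j z (cd.Tn j (cd.S j) - t) ∧
        (∀ u, 0 ≤ u → t + u ≤ cd.Tn j (s' + 1) →
          cd.InBall j (stAt φ j z u - stAt φ j q (t + u)) (cd.L1 j s' * cd.κ j) ∧
          cd.InBall j (stAt φ j z u - cd.TP j s' (t - cd.Tn j s' + u)) (cd.SpO j s')) ∧
        (∀ s'', s' < s'' → s'' ≤ cd.S j → ∃ ξ e : (Fin 4 → ℤ → ℝ),
          (∀ i k, -cd.Kb ≤ k → k ≤ cd.Ka → |ξ i k| ≤ cd.rP j s'' i k ∧
            φ j z i k (cd.Tn j s'' - t) = cd.x j s'' i k + cd.Cm j s'' ξ i k + e i k) ∧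
          cd.InBall j e (cd.EO j s'')) ∧
        (∀ s'', s' < s'' → s'' < cd.S j → ∀ u ∈ Icc 0 (cd.h j s''),
          cd.InBall j (stAt φ j z (cd.Tn j s'' - t + u) - cd.TP j s'' u) (cd.SpO j s'')) := by
  intro s' hs' t ht1 ht2 z hz
  -- certificate facts
  have hCh := hV.2.2.1
  have hω : ∀ k, 0 < cd.ω j k := G2.valid_omega_pos hV hj
  have hbb : 0 ≤ cd.bb j := (hV.2.1.2 j hj).1
  have hκ : 0 < cd.κ j := G2.valid_kappa_pos hV hj
  have hB := (hCh j hj).2.2.2.2.2.2.2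
  obtain ⟨b1, -, -, -, b5, -, b7, b8, -, -, -, -, -, -, -, -, -, -, -, b20, -⟩ := hB s' hs'
  -- chain C1–C3 for `q`
  obtain ⟨hsolq, hC2, -⟩ := chain_C123 hF hV hj hq
  -- times
  have hTn1 : cd.Tn j (s' + 1) = cd.Tn j s' + cd.h j s' := G2.valid_Tn_succ hV hj hs'
  have hTs0 : 0 ≤ cd.Tn j s' := G2.Tn_nonneg hCh hj hs'.le
  have hs1 : s' + 1 ≤ cd.S j := Nat.succ_le_of_lt hs'
  have hT1S : cd.Tn j (s' + 1) ≤ cd.Tn j (cd.S j) := G2.Tn_mono hCh hj hs1 le_rfl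
  have ht0 : 0 ≤ t := hTs0.trans ht1
  have htS : t ≤ cd.Tn j (cd.S j) := ht2.trans hT1S
  have hu₀ : t - cd.Tn j s' ∈ Icc 0 (cd.h j s') := ⟨by linarith, by linarith⟩
  have hT₁ : 0 ≤ cd.Tn j (s' + 1) - t := by linarith
  -- the base trajectory in sub-step `s'`: node `E` at `Tn j s'`, run at level `EO`
  have hNE : NodeE cd j s' (stAt φ j q (cd.Tn j s')) := by
    obtain ⟨ξ, e, hd, hE, -⟩ := hC2 s' hs'.le
    exact ⟨ξ, e, hd, hE⟩
  obtain ⟨-, hbaseO⟩ := nodeO_step hF hV hj hs' (hNE.nodeO hV hj hs'.le)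
  obtain ⟨-, hfl1⟩ := stAt_add hF hj hsolq (t := cd.Tn j s') ⟨hTs0, G2.Tn_mono hCh hj hs'.le le_rfl⟩
  have hbase : ∀ u ∈ Icc 0 (cd.h j s'),
      cd.InBall j (stAt φ j q (cd.Tn j s' + u) - cd.TP j s' u) (cd.SpO j s' - cd.L1 j s' * cd.κ j) := by
    intro u hu
    rw [hfl1 u ⟨hu.1, by linarith [hu.2]⟩]
    exact hbaseO u hu
  -- the base point `stAt φ j q t` and its window ball
  obtain ⟨m, hm⟩ : ∃ m : ℝ, m = cd.mT j s' + (cd.SpO j s' - cd.L1 j s' * cd.κ j) := ⟨_, rfl⟩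
  have hx₀ : cd.InBall j (stAt φ j q t) m := by
    have h1 := inBall_add (b5 _ hu₀) (hbase _ hu₀)
    rw [add_sub_cancel, add_sub_cancel, ← hm] at h1
    exact h1
  have hm0 : 0 ≤ m := inBall_radius_nonneg hV hj hx₀
  have hL1κ : 0 ≤ cd.L1 j s' * cd.κ j := mul_nonneg (le_trans (by positivity) b8) hκ.le
  have hmM : m + cd.κ j ≤ cd.mT j s' + cd.SpO j s' + cd.κ j := by rw [hm]; linarith
  -- guard for the restart on the rest of the sub-step
  have hg : cd.bb j * (m + cd.κ j) * (cd.Tn j (s' + 1) - t) < 1 := by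
    have h1 : (m + cd.κ j) * (cd.Tn j (s' + 1) - t) ≤ (cd.mT j s' + cd.SpO j s' + cd.κ j) * cd.h j s' :=
      mul_le_mul hmM (by linarith) hT₁ (by linarith [hκ.le])
    have h2 : cd.bb j * ((m + cd.κ j) * (cd.Tn j (s' + 1) - t)) ≤
        cd.bb j * ((cd.mT j s' + cd.SpO j s' + cd.κ j) * cd.h j s') := mul_le_mul_of_nonneg_left h1 hbb
    have h3 : cd.bb j * (m + cd.κ j) * (cd.Tn j (s' + 1) - t) ≤
        cd.bb j * (cd.mT j s' + cd.SpO j s' + cd.κ j) * cd.h j s' := by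
      rw [mul_assoc, mul_assoc]; exact h2
    exact lt_of_le_of_lt h3 b7
  -- the variation `trunc z - stAt φ j q t`
  have hv : cd.InBall j (trunc cd z - stAt φ j q t) (cd.κ j) := fun i k h1 h2 => by
    have h3 := hz i k h1 h2
    simp only [Pi.sub_apply, trunc_apply, h1, h2, and_self, if_true] at h3 ⊢
    exact h3
  have hxv : stAt φ j q t + (trunc cd z - stAt φ j q t) = trunc cd z := add_sub_cancel _ _
  have hzm : cd.InBall j z (m + cd.κ j) := by
    have h1 := inBall_add hx₀ hz
    rw [add_sub_cancel] at h1
    exact h1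
  have htm : cd.InBall j (trunc cd z) (m + cd.κ j) := inBall_trunc_iff.2 hzm
  have hmκ : 0 ≤ m + cd.κ j := by linarith [hκ.le]
  -- flow property at `t`
  obtain ⟨-, hfl2⟩ := stAt_add hF hj hsolq (t := t) ⟨ht0, htS⟩
  -- the entry deviation on the rest of the sub-step
  have hdev : ∀ u, 0 ≤ u → t + u ≤ cd.Tn j (s' + 1) →
      cd.InBall j (stAt φ j z u - stAt φ j q (t + u)) (cd.L1 j s' * cd.κ j) := by
    intro u hu0 hu1
    have huT : u ∈ Icc 0 (cd.Tn j (s' + 1) - t) := ⟨hu0, by linarith⟩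
    have h1 := (hF j hj).2.2.2.1 (stAt φ j q t) (trunc cd z - stAt φ j q t) m (cd.κ j)
      (cd.Tn j (s' + 1) - t) hm0 hκ.le hx₀ hv hT₁ hg u huT
    rw [hxv, stAt_congr_window hF hj (z := trunc cd z) (z' := z)
      (fun i k h1 h2 => by simp [trunc, h1, h2]) hmκ htm hT₁ hg huT,
      ← hfl2 u ⟨hu0, by linarith⟩] at h1
    exact inBall_mono hω h1 (lip_dev_le hbb hm0 hκ.le hu0 (by linarith : u ≤ cd.h j s') hmM b7 b8)
  -- level-`EO` node at `Tn j (s'+1)` for the restarted state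
  have hNO : NodeO cd j (s' + 1) (stAt φ j z (cd.Tn j (s' + 1) - t)) := by
    obtain ⟨ξ, e, hd, hE, -⟩ := hC2 (s' + 1) hs1
    have hΔ := hdev (cd.Tn j (s' + 1) - t) hT₁ (by linarith)
    rw [add_sub_cancel] at hΔ
    refine ⟨ξ, e + (stAt φ j z (cd.Tn j (s' + 1) - t) - stAt φ j q (cd.Tn j (s' + 1))),
      fun i k h1 h2 => ⟨(hd i k h1 h2).1, ?_⟩, inBall_mono hω (inBall_add hE hΔ) b20⟩
    have h3 := (hd i k h1 h2).2
    simp only [Pi.add_apply, Pi.sub_apply, stAt] at h3 ⊢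
    linarith
  -- the level-`EO` chain from node `s'+1`, and appending
  obtain ⟨hsol2, hN2, hS2⟩ := chain_glue_from hF hV hj (NodeO cd j) (fun s => cd.SpO j s - cd.L1 j s * cd.κ j)
    (fun s y y' hyy h => h.congr hyy) (fun s hs y h => h.inBall hV hj hs)
    (fun s hs y h => nodeO_step hF hV hj hs h) hs1 hNO
  have hsol1 : SolvesOn cd φ j z (cd.Tn j (s' + 1) - t) :=
    ((hF j hj).2.1 z (m + cd.κ j) (cd.Tn j (s' + 1) - t) hmκ hzm hT₁ hg).1
  have hT₂ : 0 ≤ cd.Tn j (cd.S j) - cd.Tn j (s' + 1) := by linarith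
  obtain ⟨hsolz, hshift⟩ := solvesOn_append hF hj hT₁ hT₂ hsol1 hsol2
  have eT : cd.Tn j (s' + 1) - t + (cd.Tn j (cd.S j) - cd.Tn j (s' + 1)) = cd.Tn j (cd.S j) - t := by ring
  rw [eT] at hsolz
  refine ⟨hsolz, fun u hu0 hu1 => ⟨hdev u hu0 hu1, ?_⟩, fun s'' h1 h2 => ?_, fun s'' h1 h2 u hu => ?_⟩
  · -- in-step `SpO` on the rest of sub-step `s'`
    have hw : t - cd.Tn j s' + u ∈ Icc 0 (cd.h j s') := ⟨by linarith, by linarith⟩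
    have h1 := inBall_add (hdev u hu0 hu1) (hbase _ hw)
    have e1 : cd.Tn j s' + (t - cd.Tn j s' + u) = t + u := by ring
    rw [e1] at h1
    have e2 : stAt φ j z u - stAt φ j q (t + u) + (stAt φ j q (t + u) - cd.TP j s' (t - cd.Tn j s' + u)) =
        stAt φ j z u - cd.TP j s' (t - cd.Tn j s' + u) := by abel
    rw [e2] at h1
    exact inBall_of_eq h1 (by ring)
  · -- node invariant at level `EO` at the later nodes
    have hss : s' + 1 ≤ s'' := Nat.succ_le_of_lt h1
    have hn := hN2 s'' hss h2
    have hmem : cd.Tn j s'' - cd.Tn j (s' + 1) ∈ Icc 0 (cd.Tn j (cd.S j) - cd.Tn j (s' + 1)) :=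
      ⟨sub_nonneg.2 (G2.Tn_mono hCh hj hss h2), sub_le_sub_right (G2.Tn_mono hCh hj h2 le_rfl) _⟩
    have e1 : stAt φ j z (cd.Tn j s'' - t) =
        stAt φ j (stAt φ j z (cd.Tn j (s' + 1) - t)) (cd.Tn j s'' - cd.Tn j (s' + 1)) := by
      rw [← hshift _ hmem]; congr 1; ring
    obtain ⟨ξ, e, hd, hEO⟩ := hn
    refine ⟨ξ, e, fun i k hk1 hk2 => ⟨(hd i k hk1 hk2).1, ?_⟩, hEO⟩
    show stAt φ j z (cd.Tn j s'' - t) i k = _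
    rw [e1]
    exact (hd i k hk1 hk2).2
  · -- in-step `SpO` in the later sub-steps
    have hss : s' + 1 ≤ s'' := Nat.succ_le_of_lt h1
    have h3 := hS2 s'' hss h2 u hu
    beta_reduce at h3
    obtain ⟨-, -, -, -, -, -, -, b8'', -⟩ := hB s'' h2
    have hL1'' : 0 ≤ cd.L1 j s'' * cd.κ j := mul_nonneg (le_trans (by positivity) b8'') hκ.le
    have hmem : cd.Tn j s'' - cd.Tn j (s' + 1) + u ∈ Icc 0 (cd.Tn j (cd.S j) - cd.Tn j (s' + 1)) := by
      refine ⟨by linarith [sub_nonneg.2 (G2.Tn_mono hCh hj hss h2.le), hu.1], ?_⟩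
      have h4 := G2.Tn_mono hCh hj (Nat.succ_le_of_lt h2) le_rfl
      rw [G2.valid_Tn_succ hV hj h2] at h4
      linarith [hu.2]
    have e1 : stAt φ j z (cd.Tn j s'' - t + u) =
        stAt φ j (stAt φ j z (cd.Tn j (s' + 1) - t)) (cd.Tn j s'' - cd.Tn j (s' + 1) + u) := by
      rw [← hshift _ hmem]; congr 1; ring
    rw [e1]
    exact inBall_mono hω h3 (by linarith)

end Restart

end Summit.NavierStokesRegularity.NavierStokesRegularity.Theorems.TaylorModelReadout

end
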